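import Literature.NumberTheory.Weil1964.ArchFollandCompact
import Literature.Analysis.SegalBargmann.FockSubstitutionEigenvectors
import HarnessLib

/-!
# Rows of the substitution `F ↦ F ∘ V⁻¹` for the block-diagonal Folland unitary of a Kronecker element `k ⊗ 1`

Topic `NumberTheory/Weil1964`; namespace `Literature.NumberTheory.Weil1964`. Proved lemmas only (finite sums and matrix
entries): **no named facts, no records, 0 proof holes**.

LEAF D1 (`ArchFollandCompact`) turns a place-by-place sign-block form-preserving family `k_v` into the block-diagonal
unitary `V = placeBlock (placeFollandUnitary … k …)` of the adapted Folland frame, and LEAF D2 (`ArchFollandCompactKType`)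
shows that an archimedean implementer acts on the Fock-polynomial vectors `follandFock e_D F` by
`vacuum coefficient • follandFock e_D (linSubst (star V) F)`.  This file reads off the ROWS of `linSubst (star V)`:

* §1 `star_placeBlock_apply`, **`linSubst_star_placeBlock_X`**: `linSubst (star (placeBlock U)) (X (i, v)) =
  Σ_{i'} conj((U v)_{i' i}) • X (i', v)` — the substitution never mixes places;
* §2 `star_follandUnitaryMatrix_apply`: for sign-block `k`, `conj((follandUnitary k)_{i' i}) = (D_{i'}/D_i) ·
  signConj ε i (conj (k_{i' i}))`;
* §3 Kronecker elements `k = reindex e e (A ⊗ₖ 1)` (the shape of `(u, 1) ∈ U(V) × U(W)` on `V ⊗ W`, pv08's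
  `placeVec_archAct_toSp_inl_mul_inr`): `reindex_kronecker_one_apply`, and sign-block inheritance
  `isSignBlock_reindex_kronecker_one` from a sign-block `A` when the sign vector factors as `ε (e (a, j)) = ε_V a · ε_W j`;
* §4 **`linSubst_star_follandUnitary_kronecker_X`**: with a PRODUCT scaling `D (e (a, j)) = D₀ a · D₁ j` (the canonical
  scaling of a Kronecker Gram matrix `diag(t_V) ⊗ diag(t_W)`), the row of `linSubst (star (follandUnitaryMatrix D ε k))`
  at the variable `X (e (a, j))` is `Σ_b (D₀ b / D₀ a) · signConj ε (e (a,j)) (conj (A b a)) • X (e (b, j))` — the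
  `W`-index `j` is inert and the `W`-scaling `D₁` cancels; combined with §1 for the block over the places.

So on the variables of one place and one `W`-column the compact element `u ∈ U(V)` acts through the `2 × 2` / `3 × 3`
matrix `N^{(j)}_{a b} = (D₀ b / D₀ a) · signConj ε (e(a,j)) (conj (A b a))` (`= D₀⁻¹ Aᵀ D₀` on `ε = +1` columns,
`D₀⁻¹ A^* D₀`… entrywise-conjugate on `ε = −1` columns), which is the input shape of LEAF D3's `linSubst_det2` /
`linSubst_pairingPoly`.  Census-time use (pub-hodgecm rows A12/A34, `SK = 𝒮^κ`): the κ-eigenvalue of the printed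
generator `det(z)` at `ι₁` is `det` of the `V₊`-block of `A = archAt w(ι₁) u`, to be compared with `archKappa u`.

## Mathlib / tree

Mathlib: `Matrix.star_eq_conjTranspose`, `Matrix.conjTranspose_apply`, `Matrix.blockDiagonal_apply'`,
`Matrix.reindex_apply`, `Matrix.submatrix_apply`, `Matrix.kronecker_apply`, `Matrix.one_apply`, `Equiv.symm_apply_apply`,
`Finset.sum_eq_single`, `Fintype.sum_prod_type`.
Tree: D1 `placeBlock` (`coe_placeBlock`), `follandUnitaryMatrix` (`follandUnitaryMatrix_apply`), `signConj`
(`conj_signConj`, `signConj_congr`, `signConj_zero`), `IsSignBlock` (`IsSignBlock.eq_of_ne_zero`); D3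
`linSubst_X_eq_sum_of_support`; `linSubst` (`linSubst_X`).

## References
* [Folland1989] G. B. Folland, *Harmonic Analysis in Phase Space*, Princeton UP (1989), Prop. (4.39), Ch. 4 §5.

## Provenance

Written under the LEAN-IN-TREE rule (2026-08-18) for the pub-hodgecm formalisation cell (HAZARD γ-K (b) / D5-arch,
STEP 3 (d), binder-2 lane gen 4; LEAF D4).  KERNEL only; all statements are proved.
-/

set_option autoImplicit false

noncomputable section

open scoped Matrix Kronecker ComplexConjugate BigOperators
open Complex MvPolynomial
open Literature.Analysis.SegalBargmann Literature.NumberTheory.Automorphic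

namespace Literature.NumberTheory.Weil1964

/-! ## §1 Rows of `star (placeBlock U)` -/

section PlaceBlock

variable {ι : Type} [Fintype ι] [DecidableEq ι] {o : Type} [Fintype o] [DecidableEq o]

/-- Entries of `star (placeBlock U)`: `conj((U v)_{i' i})` on the diagonal block `v = v'`, zero across places.
[folklore] -/
theorem star_placeBlock_apply (U : o → Matrix.unitaryGroup ι ℂ) (i i' : ι) (v v' : o) :
    (star ((placeBlock U : Matrix.unitaryGroup (ι × o) ℂ) : Matrix (ι × o) (ι × o) ℂ)) (i, v) (i', v') =
      if v = v' then star ((U v : Matrix ι ι ℂ) i' i) else 0 := by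
  rw [Matrix.star_eq_conjTranspose, Matrix.conjTranspose_apply, coe_placeBlock, Matrix.blockDiagonal_apply']
  by_cases h : v = v'
  · subst h; rw [if_pos rfl, if_pos rfl]
  · rw [if_neg (Ne.symm h), if_neg h, star_zero]

/-- **The substitution `F ↦ F ∘ (placeBlock U)⁻¹` never mixes places**: on the variable `X (i, v)` it is
`Σ_{i'} conj((U v)_{i' i}) • X (i', v)`. [cite: Folland1989, Prop (4.39)] -/
theorem linSubst_star_placeBlock_X (U : o → Matrix.unitaryGroup ι ℂ) (i : ι) (v : o) :
    linSubst (star ((placeBlock U : Matrix.unitaryGroup (ι × o) ℂ) : Matrix (ι × o) (ι × o) ℂ)) (X (i, v)) =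
      ∑ i', C (star ((U v : Matrix ι ι ℂ) i' i)) * X (i', v) := by
  rw [linSubst_X_eq_sum_of_support _ (i, v) (fun i' : ι => (i', v)) (fun a b h => (Prod.mk.inj h).1)
    (fun y' hy' => ?_)]
  · refine Finset.sum_congr rfl fun i' _ => ?_
    rw [star_placeBlock_apply, if_pos rfl]
  · obtain ⟨i', v'⟩ := y'
    rw [star_placeBlock_apply]
    have hv : v ≠ v' := fun h => hy' i' (by rw [h])
    rw [if_neg hv]

end PlaceBlock

/-! ## §2 Conjugated entries of the Folland unitary of a sign-block matrix -/

section Entries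

variable {n : Type*} [Fintype n] [DecidableEq n]

omit [Fintype n] [DecidableEq n] in
/-- `conj((follandUnitary k)_{i' i}) = (D_{i'}/D_i) · signConj ε i (conj (k_{i' i}))` for a sign-block `k`
(on a non-zero entry the two indices carry the same sign). [folklore] -/
theorem star_follandUnitaryMatrix_apply (D ε : n → ℝ) (k : Matrix n n ℂ) (hblock : IsSignBlock ε k) (i' i : n) :
    star (follandUnitaryMatrix D ε k i' i) = ((D i' / D i : ℝ) : ℂ) * signConj ε i (star (k i' i)) := by
  rw [follandUnitaryMatrix_apply, star_mul', Complex.star_def, Complex.conj_ofReal, conj_signConj]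
  by_cases h0 : k i' i = 0
  · rw [h0, map_zero, signConj_zero, signConj_zero]
  · rw [signConj_congr (hblock.eq_of_ne_zero h0)]

end Entries

/-! ## §3 Kronecker elements `reindex e e (A ⊗ₖ 1)` -/

section Kron

variable {p m ι : Type*} [Fintype p] [Fintype m] [DecidableEq p] [DecidableEq m] [Fintype ι] [DecidableEq ι]

omit [Fintype p] [Fintype m] [DecidableEq p] [Fintype ι] [DecidableEq ι] in
/-- Entries of `reindex e e (A ⊗ₖ 1)` on re-indexed pairs: `A b a` on a common `W`-column, zero otherwise. [folklore] -/
theorem reindex_kronecker_one_apply (e : p × m ≃ ι) (A : Matrix p p ℂ) (b a : p) (l j : m) :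
    (Matrix.reindex e e (A ⊗ₖ (1 : Matrix m m ℂ))) (e (b, l)) (e (a, j)) = if l = j then A b a else 0 := by
  rw [Matrix.reindex_apply, Matrix.submatrix_apply, Equiv.symm_apply_apply, Equiv.symm_apply_apply,
    Matrix.kronecker_apply, Matrix.one_apply, mul_ite, mul_one, mul_zero]

omit [Fintype p] [Fintype m] [DecidableEq p] [Fintype ι] [DecidableEq ι] in
/-- **Sign-block inheritance**: if `A` is sign-block for `ε_V` and the sign vector of the Kronecker index factors as
`ε (e (a, j)) = ε_V a · ε_W j`, then `reindex e e (A ⊗ₖ 1)` is sign-block for `ε`. [folklore] -/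
theorem isSignBlock_reindex_kronecker_one (e : p × m ≃ ι) (A : Matrix p p ℂ) {εV : p → ℝ} {εW : m → ℝ}
    {ε : ι → ℝ} (hA : IsSignBlock εV A) (hε : ∀ a j, ε (e (a, j)) = εV a * εW j) :
    IsSignBlock ε (Matrix.reindex e e (A ⊗ₖ (1 : Matrix m m ℂ))) := by
  intro i i' hne
  obtain ⟨⟨b, l⟩, rfl⟩ := e.surjective i
  obtain ⟨⟨a, j⟩, rfl⟩ := e.surjective i'
  rw [reindex_kronecker_one_apply]
  by_cases hlj : l = j
  · subst hlj
    rw [if_pos rfl]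
    apply hA b a
    intro hba
    apply hne
    rw [hε, hε, hba]
  · rw [if_neg hlj]

end Kron

/-! ## §4 The rows of `linSubst (star (follandUnitaryMatrix D ε (reindex e e (A ⊗ₖ 1))))` under a product scaling -/

section Rows

variable {p m ι : Type*} [Fintype p] [Fintype m] [DecidableEq p] [DecidableEq m] [Fintype ι] [DecidableEq ι]

omit [Fintype m] in
/-- **Row of the substitution at the variable `X (e (a, j))`** for the Folland unitary of a Kronecker element with a
PRODUCT scaling `D (e (a, j)) = D₀ a · D₁ j` (`D₁ j ≠ 0`): `Σ_b (D₀ b / D₀ a) · signConj ε (e (a, j)) (conj (A b a)) •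
X (e (b, j))` — the `W`-index is inert and the `W`-scaling cancels. [cite: Folland1989, Prop (4.39)] -/
theorem linSubst_star_follandUnitary_kronecker_X (e : p × m ≃ ι) (A : Matrix p p ℂ) {D ε : ι → ℝ} {D₀ : p → ℝ}
    {D₁ : m → ℝ} (hD : ∀ a j, D (e (a, j)) = D₀ a * D₁ j) (hD₁ : ∀ j, D₁ j ≠ 0)
    (hblock : IsSignBlock ε (Matrix.reindex e e (A ⊗ₖ (1 : Matrix m m ℂ)))) (a : p) (j : m) :
    linSubst (star (follandUnitaryMatrix D ε (Matrix.reindex e e (A ⊗ₖ (1 : Matrix m m ℂ))))) (X (e (a, j))) =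
      ∑ b, C (((D₀ b / D₀ a : ℝ) : ℂ) * signConj ε (e (a, j)) (star (A b a))) * X (e (b, j)) := by
  rw [linSubst_X_eq_sum_of_support _ (e (a, j)) (fun b : p => e (b, j))
    (fun b b' h => (Prod.mk.inj (e.injective h)).1) (fun y' hy' => ?_)]
  · refine Finset.sum_congr rfl fun b _ => ?_
    rw [Matrix.star_apply, star_follandUnitaryMatrix_apply _ _ _ hblock, reindex_kronecker_one_apply, if_pos rfl,
      hD, hD, mul_div_mul_right _ _ (hD₁ j)]
  · obtain ⟨⟨b, l⟩, rfl⟩ := e.surjective y'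
    rw [Matrix.star_apply, star_follandUnitaryMatrix_apply _ _ _ hblock, reindex_kronecker_one_apply]
    have hlj : l ≠ j := fun h => hy' b (by rw [h])
    rw [if_neg hlj, star_zero, signConj_zero, mul_zero]

omit [Fintype m] in
/-- **Row of `linSubst (star (placeBlock U))` at `X (e (a, j), v)` when the block at `v` is the Folland unitary of a
Kronecker element** with product scaling: `Σ_b (D₀ b / D₀ a) · signConj ε_v (e (a,j)) (conj (A b a)) • X (e (b, j), v)`.
[cite: Folland1989, Prop (4.39)] -/
theorem linSubst_star_placeBlock_kronecker_X {o : Type} [Fintype o] [DecidableEq o] {ι' : Type} [Fintype ι']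
    [DecidableEq ι'] (e : p × m ≃ ι') (U : o → Matrix.unitaryGroup ι' ℂ) (v : o) (A : Matrix p p ℂ) {D ε : ι' → ℝ}
    {D₀ : p → ℝ} {D₁ : m → ℝ}
    (hU : ((U v : Matrix.unitaryGroup ι' ℂ) : Matrix ι' ι' ℂ) =
      follandUnitaryMatrix D ε (Matrix.reindex e e (A ⊗ₖ (1 : Matrix m m ℂ))))
    (hD : ∀ a j, D (e (a, j)) = D₀ a * D₁ j) (hD₁ : ∀ j, D₁ j ≠ 0)
    (hblock : IsSignBlock ε (Matrix.reindex e e (A ⊗ₖ (1 : Matrix m m ℂ)))) (a : p) (j : m) :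
    linSubst (star ((placeBlock U : Matrix.unitaryGroup (ι' × o) ℂ) : Matrix (ι' × o) (ι' × o) ℂ)) (X (e (a, j), v)) =
      ∑ b, C (((D₀ b / D₀ a : ℝ) : ℂ) * signConj ε (e (a, j)) (star (A b a))) * X (e (b, j), v) := by
  rw [linSubst_star_placeBlock_X, hU]
  -- compare with the single-place row, read through `linSubst_X`
  have h := linSubst_star_follandUnitary_kronecker_X e A hD hD₁ hblock a j
  rw [linSubst_X] at h
  -- transport the identity of polynomials in the variables `ι'` along `y ↦ (y, v)`
  have h2 := congrArg (MvPolynomial.rename fun y : ι' => (y, v)) h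
  simp only [map_sum, map_mul, MvPolynomial.rename_C, MvPolynomial.rename_X, Matrix.star_apply] at h2
  simpa only [Matrix.star_apply, map_mul] using h2

end Rows

/-! ## §5 The `2 × 2` determinant generator (place `ι₁`): eigenvalue `det` of the `V₊`-block -/

section Det

variable {p m : Type*} [Fintype p] [Fintype m] [DecidableEq p] [DecidableEq m]
variable {o : Type} [Fintype o] [DecidableEq o] {ι' : Type} [Fintype ι'] [DecidableEq ι']

omit [Fintype m] in
/-- **The κ-eigenvalue of the printed generator `det(z)`.**  In the setting of `linSubst_star_placeBlock_kronecker_X`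
(block at the place `v` = Folland unitary of the Kronecker element `A ⊗ 1`, product scaling), let `α : Fin 2 ↪ p` pick
two `V`-indices and `β : Fin 2 → m` two `W`-indices such that (i) the four variables `(e (α a', β j'), v)` carry the sign
`ε = +1` (so `signConj` is conjugation there) and (ii) the columns of `A` at `α a'` are supported on the range of `α`
(sign-block `A` with a two-element block; `D₀ ≠ 0` on it).  Then the `2 × 2` determinant of those variables is a
substitution eigenvector: `linSubst (star V) (det2 x) = det (A|_α) • det2 x`. [cite: Folland1989, Prop (4.39)] -/
theorem linSubst_star_placeBlock_kronecker_det2 (e : p × m ≃ ι') (U : o → Matrix.unitaryGroup ι' ℂ) (v : o)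
    (A : Matrix p p ℂ) {D ε : ι' → ℝ} {D₀ : p → ℝ} {D₁ : m → ℝ}
    (hU : ((U v : Matrix.unitaryGroup ι' ℂ) : Matrix ι' ι' ℂ) =
      follandUnitaryMatrix D ε (Matrix.reindex e e (A ⊗ₖ (1 : Matrix m m ℂ))))
    (hD : ∀ a j, D (e (a, j)) = D₀ a * D₁ j) (hD₁ : ∀ j, D₁ j ≠ 0)
    (hblock : IsSignBlock ε (Matrix.reindex e e (A ⊗ₖ (1 : Matrix m m ℂ))))
    (α : Fin 2 → p) (hα : Function.Injective α) (β : Fin 2 → m)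
    (hD₀ : ∀ a', D₀ (α a') ≠ 0) (hε : ∀ a' j', ε (e (α a', β j')) = 1)
    (hAoff : ∀ (a' : Fin 2) (c : p), (∀ b', c ≠ α b') → A c (α a') = 0) :
    linSubst (star ((placeBlock U : Matrix.unitaryGroup (ι' × o) ℂ) : Matrix (ι' × o) (ι' × o) ℂ))
        (det2 fun a' j' => (e (α a', β j'), v)) =
      (Matrix.of fun a' b' : Fin 2 => A (α a') (α b')).det • det2 fun a' j' => (e (α a', β j'), v) := by
  -- the `2 × 2` substitution matrix on the first index
  set N : Matrix (Fin 2) (Fin 2) ℂ := Matrix.of fun a' b' => ((D₀ (α b') / D₀ (α a') : ℝ) : ℂ) * A (α b') (α a')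
    with hN
  have hdet : N.det = (Matrix.of fun a' b' : Fin 2 => A (α a') (α b')).det := by
    rw [Matrix.det_fin_two, Matrix.det_fin_two]
    simp only [hN, Matrix.of_apply]
    have h0 : (D₀ (α 0) : ℂ) ≠ 0 := Complex.ofReal_ne_zero.mpr (hD₀ 0)
    have h1 : (D₀ (α 1) : ℂ) ≠ 0 := Complex.ofReal_ne_zero.mpr (hD₀ 1)
    push_cast
    field_simp
  rw [← hdet]
  refine linSubst_det2 _ _ N fun a' j' => ?_
  rw [linSubst_star_placeBlock_kronecker_X e U v A hU hD hD₁ hblock (α a') (β j')]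
  -- restrict the sum over `b : p` to the range of `α`
  have himg : ∑ b' : Fin 2, C (N a' b') * X (e (α b', β j'), v) =
      ∑ b ∈ (Finset.univ : Finset (Fin 2)).image α,
        C (((D₀ b / D₀ (α a') : ℝ) : ℂ) * signConj ε (e (α a', β j')) (star (A b (α a')))) *
          (X (e (b, β j'), v) : MvPolynomial (ι' × o) ℂ) := by
    rw [Finset.sum_image fun b₁ _ b₂ _ h => hα h]
    refine Finset.sum_congr rfl fun b' _ => ?_
    rw [hN, Matrix.of_apply, signConj_of_eq_one (hε a' j'), Complex.star_def, Complex.conj_conj]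
  rw [himg]
  symm
  refine Finset.sum_subset (Finset.subset_univ _) fun b _ hb => ?_
  have h0 : A b (α a') = 0 := hAoff a' b fun b' hb' => hb (Finset.mem_image.mpr ⟨b', Finset.mem_univ _, hb'.symm⟩)
  rw [h0, star_zero, signConj_zero, mul_zero, C_0, zero_mul]

end Det

/-! ## §6 The pairing generator (places of kind `Σ₁₂`): invariance -/

section Pairing

variable {p m : Type*} [Fintype p] [Fintype m] [DecidableEq p] [DecidableEq m]
variable {o : Type} [Fintype o] [DecidableEq o] {ι' : Type} [Fintype ι'] [DecidableEq ι']

omit [Fintype m] [DecidableEq m] in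
/-- **Row orthogonality from form preservation.**  If `A` preserves `diag(t)` (`Āᵀ diag(t) A = diag(t)`), is
sign-block for a CONSTANT sign (`ε_V ≡ ε₀`, a definite place) and the scaling `D₀` is adapted (`m D₀_a² = ε₀ t_a`,
`m ≠ 0`, `t_a ≠ 0`), then the ROWS of `A` are orthonormal for the weight `D₀`:
`Σ_a A_{b a} conj(A_{c a}) · (D₀_b D₀_c / D₀_a²) = δ_{b c}` (`D₀ A D₀⁻¹` is unitary, so is its transpose-side product).
[folklore] -/
theorem sum_mul_star_mul_eq_of_form {mm : ℝ} (hm : mm ≠ 0) {t D₀ : p → ℝ} {ε₀ : ℝ} (ht : ∀ a, t a ≠ 0)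
    (hD : ∀ a, mm * D₀ a ^ 2 = ε₀ * t a) (hε : ε₀ = 1 ∨ ε₀ = -1) (A : GL p ℂ)
    (hform : A ∈ unitaryGroupOfForm (starRingEnd ℂ) ((Matrix.diagonal t).map Complex.ofRealHom)) (b c : p) :
    ∑ a, (A : Matrix p p ℂ) b a * star ((A : Matrix p p ℂ) c a) * ((D₀ b * D₀ c / D₀ a ^ 2 : ℝ) : ℂ) =
      if b = c then 1 else 0 := by
  have hD0 : ∀ a, D₀ a ≠ 0 := scale_ne_zero_of_adapted (ε := fun _ => ε₀) ht hD (fun _ => hε)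
  -- `B := D₀ A D₀⁻¹` is unitary: `Bᴴ B = 1` from D1's column identity, hence `B Bᴴ = 1`
  set B : Matrix p p ℂ := Matrix.of fun l i => ((D₀ l / D₀ i : ℝ) : ℂ) * (A : Matrix p p ℂ) l i with hB
  have hcol := sum_conj_mul_sq_mul_eq (ε := fun _ => ε₀) hm hD (fun _ => hε) A hform
    (fun i j h => absurd rfl h)
  have hBB : Bᴴ * B = 1 := by
    ext i j
    rw [Matrix.mul_apply, Matrix.one_apply]
    have hterm : ∀ l, Bᴴ i l * B l j = ((1 / (D₀ i * D₀ j) : ℝ) : ℂ) *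
        (conj ((A : Matrix p p ℂ) l i) * ((D₀ l ^ 2 : ℝ) : ℂ) * (A : Matrix p p ℂ) l j) := by
      intro l
      rw [Matrix.conjTranspose_apply, hB, Matrix.of_apply, Matrix.of_apply, star_mul', Complex.star_def,
        Complex.conj_ofReal]
      have h1 := hD0 i; have h2 := hD0 j; have h3 := hD0 l
      push_cast
      field_simp
    simp only [hterm, ← Finset.mul_sum, hcol i j]
    split_ifs with h
    · subst h
      have h1 : (D₀ i : ℂ) ≠ 0 := Complex.ofReal_ne_zero.mpr (hD0 i)
      push_cast; field_simp
    · rw [mul_zero]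
  have hBB' : B * Bᴴ = 1 := mul_eq_one_comm.1 hBB
  have hbc := congrFun (congrFun hBB' b) c
  rw [Matrix.mul_apply, Matrix.one_apply] at hbc
  rw [← hbc]
  refine Finset.sum_congr rfl fun a _ => ?_
  rw [Matrix.conjTranspose_apply, hB, Matrix.of_apply, Matrix.of_apply, star_mul', Complex.star_def,
    Complex.conj_ofReal]
  have h1 : (D₀ a : ℂ) ≠ 0 := Complex.ofReal_ne_zero.mpr (hD0 a)
  push_cast
  field_simp

omit [Fintype m] in
/-- **The pairing generator `Σ_a z_a w_a` is invariant** (place of kind `Σ₁₂`: `V` definite, `W = W₊ ⊕ W₋`).  In the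
setting of `linSubst_star_placeBlock_kronecker_X`, let the `W`-column `j₊` carry `ε = +1` and the column `j₋` carry
`ε = −1` on all rows, and let the rows of `A` be `D₀`-orthonormal (previous lemma).  Then
`linSubst (star V) (pairingPoly z w) = pairingPoly z w` for `z a = (e (a, j₊), v)`, `w a = (e (a, j₋), v)`.
[cite: Folland1989, Prop (4.39)] -/
theorem linSubst_star_placeBlock_kronecker_pairingPoly (e : p × m ≃ ι') (U : o → Matrix.unitaryGroup ι' ℂ) (v : o)
    (A : Matrix p p ℂ) {D ε : ι' → ℝ} {D₀ : p → ℝ} {D₁ : m → ℝ}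
    (hU : ((U v : Matrix.unitaryGroup ι' ℂ) : Matrix ι' ι' ℂ) =
      follandUnitaryMatrix D ε (Matrix.reindex e e (A ⊗ₖ (1 : Matrix m m ℂ))))
    (hD : ∀ a j, D (e (a, j)) = D₀ a * D₁ j) (hD₁ : ∀ j, D₁ j ≠ 0)
    (hblock : IsSignBlock ε (Matrix.reindex e e (A ⊗ₖ (1 : Matrix m m ℂ))))
    (jp jm : m) (hεp : ∀ a, ε (e (a, jp)) = 1) (hεm : ∀ a, ε (e (a, jm)) = -1)
    (hrow : ∀ b c, ∑ a, A b a * star (A c a) * ((D₀ b * D₀ c / D₀ a ^ 2 : ℝ) : ℂ) = if b = c then 1 else 0) :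
    linSubst (star ((placeBlock U : Matrix.unitaryGroup (ι' × o) ℂ) : Matrix (ι' × o) (ι' × o) ℂ))
        (pairingPoly (fun a => (e (a, jp), v)) (fun a => (e (a, jm), v))) =
      pairingPoly (fun a => (e (a, jp), v)) (fun a => (e (a, jm), v)) := by
  refine linSubst_pairingPoly _ _ _ (Matrix.of fun a b => ((D₀ b / D₀ a : ℝ) : ℂ) * A b a)
    (Matrix.of fun a b => ((D₀ b / D₀ a : ℝ) : ℂ) * star (A b a)) (fun a => ?_) (fun a => ?_) ?_
  · rw [linSubst_star_placeBlock_kronecker_X e U v A hU hD hD₁ hblock a jp]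
    refine Finset.sum_congr rfl fun b _ => ?_
    rw [Matrix.of_apply, signConj_of_eq_one (hεp a), Complex.star_def, Complex.conj_conj]
  · rw [linSubst_star_placeBlock_kronecker_X e U v A hU hD hD₁ hblock a jm]
    refine Finset.sum_congr rfl fun b _ => ?_
    rw [Matrix.of_apply, signConj_of_ne_one (by rw [hεm a]; norm_num)]
  · ext b c
    rw [Matrix.mul_apply, Matrix.one_apply, ← hrow b c]
    refine Finset.sum_congr rfl fun a _ => ?_
    rw [Matrix.transpose_apply, Matrix.of_apply, Matrix.of_apply]
    push_cast
    ring

end Pairing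

end Literature.NumberTheory.Weil1964

end
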